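import Literature.AlgebraicGeometry.Deformation.SmoothSchemeLiftObstructionCriterionGlueLineBundleCocycle
import Literature.AlgebraicGeometry.Deformation.SmoothSchemeLiftObstructionCriterionGlueChartsBijective
import Literature.AlgebraicGeometry.Deformation.PairLiftTwistedCocycleObstruction
import Literature.AlgebraicGeometry.Modules.FrameTransition
import Literature.AlgebraicGeometry.Modules.UnitCocycle
import HarnessLib

/-!
# Gluing the lifted charts, VI-d: the converse — a module framed on the chart images of the glued deformation IS an exact
# twisted unit cocycle (Hartshorne, *Algebraic Geometry* II Ex. 5.18 (b), read through *Deformation Theory* Thm. 10.2)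

Layer `Literature/AlgebraicGeometry/Deformation` (cell `hodgecm-mathlib`, F-11 sub-line `F11SmoothRoadA`, α1 grandchild
`F11LiftWithLineBundle`, junction D0∕S7 (J2) of stub G2; THEOREMS ONLY — no definition, no instance, no notation, no named fact).
Sequel of `…CriterionGlueLineBundleCocycle` (same `variable`s VERBATIM; overlap sections characterised by their chart-`j` readings)
and of `…CriterionGlueChartsBijective` (chart ring maps over PRINCIPAL opens are bijective — the one extra input of the converse).
* `twistedCocycle_of_overlapSection_mul` — the CONVERSE READING: if the overlap sections `g_{jl}` of `G j l ∈ R ⊗_k Γ(U j ∩ U l)`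
  satisfy the honest cocycle `g_{jl}| · g_{lm}| = g_{jm}|` on the triple chart intersections, the `G j l` satisfy the EXACT TWISTED
  cocycle identity `Φjm (G j m) = Φjl (G j l) · τjl (Φlm (G l m))` for all characterised `Φ`, `τjl` (injectivity of `Λ` over
  `U j ∩ U l ∩ U m = D(b_{jl} b_{jm})`; uniqueness of `τjl` is ★ `PairLiftTwistedCocycleObstruction.algEquiv_restrict_symm_unique`).
* `isUnit_of_isUnit_overlapSection` — units read units (bijectivity of `Λ_{jl}` over `U j ∩ U l = D(b_{jl})`).
* **`exists_twistedCocycle_of_frames`** — THE HEAD: a module `M` on `X'` with rank-one frames `f_j` on the chart images yields UNITS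
  `G j l` with the exact twisted cocycle identity whose overlap sections are the transition functions `T(f_j, f_l)` (surjectivity of
  `Λ_{jl}`; ★ `Modules.transition_mul`, `transition_mul_symm`, `transition_map`).  Its four conjuncts are, letter for letter, the inputs
  `hGu`∕`hs`∕`hGcoc` of `…GlueLineBundleCocycle`∕`…GlueLineBundle` and the `(L', e', he')` slot of
  `…GlueLineBundleBaseChange.nonempty_pullback_iso_of_overlapSections`.  Consumer (G2 assembler): `M := eY^* L₀` for the F3c c2c
  identification `eY : Glue_{A⧸J}(φ) ≅ A₀.X`, framed by the pulled-back trivialisations of `L₀ = Gr₀^* 𝒫₀`.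
HC_CM is proved only modulo the 7 printed citations until rung 0 closes — nothing here bears on a summit statement.

## References
* [Hartshorne1977] R. Hartshorne, *Algebraic Geometry*, GTM 52 (1977): II Ex. 5.18 (b) (transition data of a locally free sheaf).
* [Hartshorne2010] R. Hartshorne, *Deformation Theory*, GTM 257 (2010): Thm. 6.4 (a) proof (pp. 50–51), Thm. 10.2 (a) proof (p. 81).
* [StacksProject] The Stacks Project, Tag 01JA (glueing schemes).
-/

noncomputable section

-- `TopCat.Presheaf`/`TopCat.Sheaf` are not reducible (as in Mathlib's `AlgebraicGeometry/Modules`).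
set_option backward.isDefEq.respectTransparency false

open CategoryTheory AlgebraicGeometry Opposite TopologicalSpace Limits
open scoped TensorProduct

universe u

namespace Literature.AlgebraicGeometry.Deformation
section J2

open Literature.AlgebraicGeometry.Motives Literature.AlgebraicGeometry.Morphisms Literature.AlgebraicGeometry.Modules

variable {k : Type u} [Field k] {X : Over (Spec (CommRingCat.of k))}
  [instΓ : ∀ W : X.left.Opens, Algebra k Γ(X.left, W)]
  (halg : ∀ (W : X.left.Opens) (s : k), algebraMap k Γ(X.left, W) s = (constToPresheaf X).app (op W) s)
  (R : Type u) [CommRing R] [Algebra k R]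
  {ι : Type u} (U : ι → X.left.affineOpens) (b : (j l : ι) → Γ(X.left, (U j).1))
  (hb : ∀ j l, (U j).1 ⊓ (U l).1 = X.left.basicOpen (b j l))
  (ψ : (j l : ι) → R ⊗[k] Γ(X.left, (U j).1 ⊓ (U l).1) ≃ₐ[R] R ⊗[k] Γ(X.left, (U j).1 ⊓ (U l).1))
  (𝔫 : Ideal R) (h𝔫 : IsNilpotent 𝔫)
  (hψ : ∀ j l x, ψ j l x - x ∈ 𝔫 • (⊤ : Submodule R (R ⊗[k] Γ(X.left, (U j).1 ⊓ (U l).1))))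
  (hcoc : ∀ (j l m : ι)
    (Φjl : R ⊗[k] Γ(X.left, (U j).1 ⊓ (U l).1) →ₐ[R] R ⊗[k] Γ(X.left, (U j).1 ⊓ (U l).1 ⊓ (U m).1))
    (_ : ∀ a s, Φjl (a ⊗ₜ s) = a ⊗ₜ X.left.presheaf.map (homOfLE inf_le_left).op s)
    (Φlm : R ⊗[k] Γ(X.left, (U l).1 ⊓ (U m).1) →ₐ[R] R ⊗[k] Γ(X.left, (U j).1 ⊓ (U l).1 ⊓ (U m).1))
    (_ : ∀ a s, Φlm (a ⊗ₜ s) = a ⊗ₜ X.left.presheaf.map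
      (homOfLE (le_inf (inf_le_left.trans inf_le_right) inf_le_right)).op s)
    (Φjm : R ⊗[k] Γ(X.left, (U j).1 ⊓ (U m).1) →ₐ[R] R ⊗[k] Γ(X.left, (U j).1 ⊓ (U l).1 ⊓ (U m).1))
    (_ : ∀ a s, Φjm (a ⊗ₜ s) = a ⊗ₜ X.left.presheaf.map
      (homOfLE (le_inf (inf_le_left.trans inf_le_left) inf_le_right)).op s)
    (ρjl ρlm ρjm : R ⊗[k] Γ(X.left, (U j).1 ⊓ (U l).1 ⊓ (U m).1) ≃ₐ[R]
      R ⊗[k] Γ(X.left, (U j).1 ⊓ (U l).1 ⊓ (U m).1)),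
    (∀ x, ρjl (Φjl x) = Φjl (ψ j l x)) → (∀ x, ρlm (Φlm x) = Φlm (ψ l m x)) →
    (∀ x, ρjm (Φjm x) = Φjm (ψ j m x)) → ρlm * ρjl = ρjm)

variable (G : (j l : ι) → R ⊗[k] Γ(X.left, (U j).1 ⊓ (U l).1))

include hb h𝔫 hψ in
set_option maxHeartbeats 800000 in -- as `overlapSection_mul` (FILE 1c's transition reading)
/-- **THE CONVERSE READING: an honest cocycle of sections on the glued deformation is an EXACT TWISTED cocycle in the
charts.**  If `G j l ∈ R ⊗_k Γ(U j ∩ U l)` have overlap sections `g_{jl}` (their chart-`j` readings are the `Λ_{jl} (G j l)`) which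
satisfy the honest cocycle identity `g_{jl}| · g_{lm}| = g_{jm}|` on the triple chart intersections (e.g. the transition functions
of a module framed on the chart images), then the `G j l` satisfy the twisted cocycle identity
`Φjm (G j m) = Φjl (G j l) · τjl (Φlm (G l m))` for ALL characterised base changes `Φ` and restrictions `τjl` of `(ψ j l)⁻¹`
(the converse of `overlapSection_mul`; the extra input is the INJECTIVITY of the chart ring map over the principal open
`U j ∩ U l ∩ U m = D(b_{jl} b_{jm})`, `…GlueChartsBijective.chartRingHom_bijective`).
[cite: Hartshorne2010, Thm. 6.4 (a) (proof, pp. 50–51)] [cite: Hartshorne1977, II Ex. 5.18 (b)] [cite: StacksProject, Tag 01JA] -/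
theorem twistedCocycle_of_overlapSection_mul
    (s : (j l : ι) →
      Γ((deformationGlueDatum halg R U b hb ψ 𝔫 h𝔫 hψ hcoc).glueData.glued,
        ((deformationGlueDatum halg R U b hb ψ 𝔫 h𝔫 hψ hcoc).glueData.ι j).opensRange ⊓
          ((deformationGlueDatum halg R U b hb ψ 𝔫 h𝔫 hψ hcoc).glueData.ι l).opensRange))
    (hs : ∀ j l, ((chartOverlap R U j l).ι ≫ (deformationGlueDatum halg R U b hb ψ 𝔫 h𝔫 hψ hcoc).glueData.ι j).appLE
        (((deformationGlueDatum halg R U b hb ψ 𝔫 h𝔫 hψ hcoc).glueData.ι j).opensRange ⊓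
          ((deformationGlueDatum halg R U b hb ψ 𝔫 h𝔫 hψ hcoc).glueData.ι l).opensRange) ⊤
        (top_le_preimage_opensRange_inf halg R U b hb ψ 𝔫 h𝔫 hψ hcoc j l) (s j l) =
      overlapRingHom halg R U j l (G j l))
    (hmul : ∀ j l m : ι,
      (deformationGlueDatum halg R U b hb ψ 𝔫 h𝔫 hψ hcoc).glueData.glued.presheaf.map
          (homOfLE (inf_le_left :
            ((deformationGlueDatum halg R U b hb ψ 𝔫 h𝔫 hψ hcoc).glueData.ι j).opensRange ⊓
                ((deformationGlueDatum halg R U b hb ψ 𝔫 h𝔫 hψ hcoc).glueData.ι l).opensRange ⊓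
                ((deformationGlueDatum halg R U b hb ψ 𝔫 h𝔫 hψ hcoc).glueData.ι m).opensRange ≤
              ((deformationGlueDatum halg R U b hb ψ 𝔫 h𝔫 hψ hcoc).glueData.ι j).opensRange ⊓
                ((deformationGlueDatum halg R U b hb ψ 𝔫 h𝔫 hψ hcoc).glueData.ι l).opensRange)).op (s j l) *
        (deformationGlueDatum halg R U b hb ψ 𝔫 h𝔫 hψ hcoc).glueData.glued.presheaf.map
          (homOfLE (le_inf (inf_le_left.trans inf_le_right) inf_le_right :
            ((deformationGlueDatum halg R U b hb ψ 𝔫 h𝔫 hψ hcoc).glueData.ι j).opensRange ⊓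
                ((deformationGlueDatum halg R U b hb ψ 𝔫 h𝔫 hψ hcoc).glueData.ι l).opensRange ⊓
                ((deformationGlueDatum halg R U b hb ψ 𝔫 h𝔫 hψ hcoc).glueData.ι m).opensRange ≤
              ((deformationGlueDatum halg R U b hb ψ 𝔫 h𝔫 hψ hcoc).glueData.ι l).opensRange ⊓
                ((deformationGlueDatum halg R U b hb ψ 𝔫 h𝔫 hψ hcoc).glueData.ι m).opensRange)).op (s l m) =
        (deformationGlueDatum halg R U b hb ψ 𝔫 h𝔫 hψ hcoc).glueData.glued.presheaf.map
          (homOfLE (le_inf (inf_le_left.trans inf_le_left) inf_le_right :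
            ((deformationGlueDatum halg R U b hb ψ 𝔫 h𝔫 hψ hcoc).glueData.ι j).opensRange ⊓
                ((deformationGlueDatum halg R U b hb ψ 𝔫 h𝔫 hψ hcoc).glueData.ι l).opensRange ⊓
                ((deformationGlueDatum halg R U b hb ψ 𝔫 h𝔫 hψ hcoc).glueData.ι m).opensRange ≤
              ((deformationGlueDatum halg R U b hb ψ 𝔫 h𝔫 hψ hcoc).glueData.ι j).opensRange ⊓
                ((deformationGlueDatum halg R U b hb ψ 𝔫 h𝔫 hψ hcoc).glueData.ι m).opensRange)).op (s j m)) :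
    ∀ (j l m : ι)
      (Φjl : R ⊗[k] Γ(X.left, (U j).1 ⊓ (U l).1) →ₐ[R] R ⊗[k] Γ(X.left, (U j).1 ⊓ (U l).1 ⊓ (U m).1))
      (_ : ∀ a s, Φjl (a ⊗ₜ s) = a ⊗ₜ X.left.presheaf.map (homOfLE inf_le_left).op s)
      (Φlm : R ⊗[k] Γ(X.left, (U l).1 ⊓ (U m).1) →ₐ[R] R ⊗[k] Γ(X.left, (U j).1 ⊓ (U l).1 ⊓ (U m).1))
      (_ : ∀ a s, Φlm (a ⊗ₜ s) = a ⊗ₜ X.left.presheaf.map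
        (homOfLE (le_inf (inf_le_left.trans inf_le_right) inf_le_right)).op s)
      (Φjm : R ⊗[k] Γ(X.left, (U j).1 ⊓ (U m).1) →ₐ[R] R ⊗[k] Γ(X.left, (U j).1 ⊓ (U l).1 ⊓ (U m).1))
      (_ : ∀ a s, Φjm (a ⊗ₜ s) = a ⊗ₜ X.left.presheaf.map
        (homOfLE (le_inf (inf_le_left.trans inf_le_left) inf_le_right)).op s)
      (τjl : R ⊗[k] Γ(X.left, (U j).1 ⊓ (U l).1 ⊓ (U m).1) ≃ₐ[R] R ⊗[k] Γ(X.left, (U j).1 ⊓ (U l).1 ⊓ (U m).1)),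
      (∀ x, τjl (Φjl (ψ j l x)) = Φjl x) → Φjm (G j m) = Φjl (G j l) * τjl (Φlm (G l m)) := by
  intro j l m Φjl hΦjl Φlm hΦlm Φjm hΦjm τjl hτjl
  -- §A the restriction `ρjl` of `ψ j l` along the GIVEN base change; the given `τjl` is its inverse
  have hV'jl : (U j).1 ⊓ (U l).1 ⊓ (U m).1 ≤ (U j).1 ⊓ (U l).1 := inf_le_left
  have hV'lm : (U j).1 ⊓ (U l).1 ⊓ (U m).1 ≤ (U l).1 ⊓ (U m).1 :=
    le_inf (inf_le_left.trans inf_le_right) inf_le_right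
  have hV'jm : (U j).1 ⊓ (U l).1 ⊓ (U m).1 ≤ (U j).1 ⊓ (U m).1 :=
    le_inf (inf_le_left.trans inf_le_left) inf_le_right
  obtain ⟨ρjl, hρjl, -⟩ := exists_algEquiv_restrict (A' := R) halg 𝔫 (V := (U j).1 ⊓ (U l).1)
    (W := (U j).1 ⊓ (U l).1 ⊓ (U m).1) (isAffineOpen_inf₂ U b hb j l)
    (X.left.presheaf.map (homOfLE (inf_le_left : (U j).1 ⊓ (U l).1 ≤ (U j).1)).op (b j m))
    (inf_eq_basicOpen_map U b hb inf_le_left m) hV'jl h𝔫 (ψ j l) (hψ j l) (Φ := Φjl) hΦjl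
  have hτ : τjl = ρjl.symm :=
    algEquiv_restrict_symm_unique halg (isAffineOpen_inf₂ U b hb j l)
      (X.left.presheaf.map (homOfLE (inf_le_left : (U j).1 ⊓ (U l).1 ≤ (U j).1)).op (b j m))
      (inf_eq_basicOpen_map U b hb inf_le_left m) hV'jl (ψ j l) hΦjl hτjl
      (fun x => by rw [AlgEquiv.symm_apply_eq, hρjl])
  rw [hτ]
  -- §B the open `O = W j l ∩ W j m` of chart `j`; its inclusions `a`, `c` and its transition `b'` into `W l m`
  obtain ⟨O, hOdef⟩ : ∃ O : (Spec (CommRingCat.of (R ⊗[k] Γ(X.left, (U j).1)))).Opens,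
      O = chartOverlap R U j l ⊓ chartOverlap R U j m := ⟨_, rfl⟩
  have hOjl : O ≤ chartOverlap R U j l := hOdef ▸ inf_le_left
  have hOjm : O ≤ chartOverlap R U j m := hOdef ▸ inf_le_right
  obtain ⟨a, ha⟩ : ∃ a : (O : Scheme.{u}) ⟶ (chartOverlap R U j l : (Spec (CommRingCat.of
      (R ⊗[k] Γ(X.left, (U j).1)))).Opens), a ≫ (chartOverlap R U j l).ι = O.ι :=
    ⟨Scheme.homOfLE _ hOjl, Scheme.homOfLE_ι _ _⟩
  obtain ⟨c, hc⟩ : ∃ c : (O : Scheme.{u}) ⟶ (chartOverlap R U j m : (Spec (CommRingCat.of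
      (R ⊗[k] Γ(X.left, (U j).1)))).Opens), c ≫ (chartOverlap R U j m).ι = O.ι :=
    ⟨Scheme.homOfLE _ hOjm, Scheme.homOfLE_ι _ _⟩
  have hrange : Set.range (a ≫ transitionMap halg R U ψ j l) ⊆ Set.range (chartOverlap R U l m).ι := by
    rintro _ ⟨x, rfl⟩
    rw [Scheme.Opens.range_ι]
    have hx : ((chartOverlap R U j l).ι (a x)) ∈ chartOverlap R U j m := by
      rw [← Scheme.Hom.comp_apply, ha, Scheme.Opens.ι_apply]
      exact hOjm x.2
    exact (deformationGlueDatum halg R U b hb ψ 𝔫 h𝔫 hψ hcoc).dom j l m (a x) hx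
  obtain ⟨b', hb'⟩ : ∃ b' : (O : Scheme.{u}) ⟶ (chartOverlap R U l m : (Spec (CommRingCat.of
      (R ⊗[k] Γ(X.left, (U l).1)))).Opens), b' ≫ (chartOverlap R U l m).ι = a ≫ transitionMap halg R U ψ j l :=
    ⟨IsOpenImmersion.lift _ _ hrange, IsOpenImmersion.lift_fac _ _ hrange⟩
  have hb'' : b' ≫ (chartOverlap R U l m).ι = a ≫ ((chartOverlap R U j l : (Spec (CommRingCat.of
      (R ⊗[k] Γ(X.left, (U j).1)))).Opens) : Scheme.{u}).toSpecΓ ≫ Spec.map (CommRingCat.ofHom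
      ((overlapRingHom halg R U j l).comp
        ((ψ j l).symm.toAlgHom.toRingHom.comp (baseChangeRight halg R U j l).toRingHom))) := by
    rw [hb', transitionMap_eq]
  -- §C the chart ring map of `O` over `U j ∩ U l ∩ U m` and the three readings
  have hO : ⊤ ≤ (O.ι ≫ chartProj R U j) ⁻¹ᵁ ((U j).1 ⊓ (U l).1 ⊓ (U m).1) := by
    intro x _
    change chartProj R U j (O.ι x) ∈ (U j).1 ⊓ (U l).1 ⊓ (U m).1
    rw [Scheme.Opens.ι_apply]
    exact ⟨hOjl x.2, (hOjm x.2).2⟩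
  have hO₁ : ⊤ ≤ (O.ι ≫ chartProj R U j) ⁻¹ᵁ ((U j).1 ⊓ (U l).1) := fun x hx => hV'jl (hO hx)
  have hO₂ : ⊤ ≤ (O.ι ≫ chartProj R U j) ⁻¹ᵁ ((U j).1 ⊓ (U m).1) := fun x hx => hV'jm (hO hx)
  obtain ⟨ΛO, hΛO, hΛO'⟩ := exists_chartRingHom halg (U j).2 (chartProj R U j) rfl O
    ((inf_le_left.trans inf_le_left : (U j).1 ⊓ (U l).1 ⊓ (U m).1 ≤ (U j).1)) hO
  obtain ⟨ΛO₁, hΛO₁, hΛO₁'⟩ := exists_chartRingHom halg (U j).2 (chartProj R U j) rfl O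
    (inf_le_left : (U j).1 ⊓ (U l).1 ≤ (U j).1) hO₁
  obtain ⟨ΛO₂, hΛO₂, hΛO₂'⟩ := exists_chartRingHom halg (U j).2 (chartProj R U j) rfl O
    (inf_le_left : (U j).1 ⊓ (U m).1 ≤ (U j).1) hO₂
  have ejl : a.appTop.hom.comp (overlapRingHom halg R U j l) = ΛO.comp Φjl.toRingHom :=
    (comp_chartRingHom (chartProj R U j) a ha (overlapRingHom_tmul_one halg R U j l)
      (overlapRingHom_one_tmul halg R U j l) hΛO₁ hΛO₁').trans
      (chartRingHom_comp_baseChange (chartProj R U j) hV'jl hΛO₁ hΛO₁' hΛO hΛO' hΦjl).symm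
  have ejm : c.appTop.hom.comp (overlapRingHom halg R U j m) = ΛO.comp Φjm.toRingHom :=
    (comp_chartRingHom (chartProj R U j) c hc (overlapRingHom_tmul_one halg R U j m)
      (overlapRingHom_one_tmul halg R U j m) hΛO₂ hΛO₂').trans
      (chartRingHom_comp_baseChange (chartProj R U j) hV'jm hΛO₂ hΛO₂' hΛO hΛO' hΦjm).symm
  have hψjl : ∀ x, IsNilpotent (ψ j l x - x) := fun x =>
    SmoothAffineDeformation.isNilpotent_of_mem_smul_top 𝔫 h𝔫 (hψ j l x)
  have elm : b'.appTop.hom.comp (overlapRingHom halg R U l m) =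
      ΛO.comp (ρjl.symm.toAlgHom.toRingHom.comp Φlm.toRingHom) :=
    comp_chartRingHom_of_transition halg (U j).2 (U l).2 (isAffineOpen_inf₂ U b hb j l) (chartProj R U j) rfl
      (chartProj R U l) rfl
      (X.left.presheaf.map (homOfLE (inf_le_left : (U j).1 ⊓ (U l).1 ≤ (U j).1)).op (b j m))
      (inf_eq_basicOpen_map U b hb inf_le_left m) hV'jl hV'lm
      (chartOverlap_le R U j l) (overlapRingHom_tmul_one halg R U j l) (overlapRingHom_one_tmul halg R U j l)
      (chartOverlap_le R U l m) (overlapRingHom_tmul_one halg R U l m) (overlapRingHom_one_tmul halg R U l m)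
      (ψ j l) hψjl (baseChangeRight_tmul halg R U j l) a ha b' hb'' hO hΛO hΛO' hΦjl hΦlm hρjl
  -- §D the reading map `Γ(X', V_jlm) → Γ(O)` through chart `j` is injective
  have hpre : (deformationGlueDatum halg R U b hb ψ 𝔫 h𝔫 hψ hcoc).glueData.ι j ⁻¹ᵁ (((deformationGlueDatum halg R U b hb ψ 𝔫 h𝔫 hψ hcoc).glueData.ι j).opensRange ⊓ ((deformationGlueDatum halg R U b hb ψ 𝔫 h𝔫 hψ hcoc).glueData.ι l).opensRange ⊓
      ((deformationGlueDatum halg R U b hb ψ 𝔫 h𝔫 hψ hcoc).glueData.ι m).opensRange) = O := by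
    rw [Scheme.Hom.preimage_inf, Scheme.Hom.preimage_inf, Scheme.Hom.preimage_opensRange, top_inf_eq,
      glued_preimage_opensRange, glued_preimage_opensRange, hOdef]
  have hF : ⊤ ≤ (O.ι ≫ (deformationGlueDatum halg R U b hb ψ 𝔫 h𝔫 hψ hcoc).glueData.ι j) ⁻¹ᵁ (((deformationGlueDatum halg R U b hb ψ 𝔫 h𝔫 hψ hcoc).glueData.ι j).opensRange ⊓ ((deformationGlueDatum halg R U b hb ψ 𝔫 h𝔫 hψ hcoc).glueData.ι l).opensRange ⊓
      ((deformationGlueDatum halg R U b hb ψ 𝔫 h𝔫 hψ hcoc).glueData.ι m).opensRange) := by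
    rw [Scheme.Hom.comp_preimage, hpre, Scheme.Opens.ι_preimage_self]
  have hFrange : (O.ι ≫ (deformationGlueDatum halg R U b hb ψ 𝔫 h𝔫 hψ hcoc).glueData.ι j).opensRange = ((deformationGlueDatum halg R U b hb ψ 𝔫 h𝔫 hψ hcoc).glueData.ι j).opensRange ⊓
      ((deformationGlueDatum halg R U b hb ψ 𝔫 h𝔫 hψ hcoc).glueData.ι l).opensRange ⊓ ((deformationGlueDatum halg R U b hb ψ 𝔫 h𝔫 hψ hcoc).glueData.ι m).opensRange := by
    rw [Scheme.Hom.opensRange_comp, Scheme.Opens.opensRange_ι, ← hpre, Scheme.Hom.image_preimage_eq_opensRange_inf,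
      ← inf_assoc, ← inf_assoc, inf_idem]
  -- §E the three readings through chart `j`
  have hFa : O.ι ≫ (deformationGlueDatum halg R U b hb ψ 𝔫 h𝔫 hψ hcoc).glueData.ι j = a ≫ ((chartOverlap R U j l).ι ≫ (deformationGlueDatum halg R U b hb ψ 𝔫 h𝔫 hψ hcoc).glueData.ι j) := by
    rw [← Category.assoc, ha]
  have hFc : O.ι ≫ (deformationGlueDatum halg R U b hb ψ 𝔫 h𝔫 hψ hcoc).glueData.ι j = c ≫ ((chartOverlap R U j m).ι ≫ (deformationGlueDatum halg R U b hb ψ 𝔫 h𝔫 hψ hcoc).glueData.ι j) := by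
    rw [← Category.assoc, hc]
  have hFb : O.ι ≫ (deformationGlueDatum halg R U b hb ψ 𝔫 h𝔫 hψ hcoc).glueData.ι j = b' ≫ ((chartOverlap R U l m).ι ≫ (deformationGlueDatum halg R U b hb ψ 𝔫 h𝔫 hψ hcoc).glueData.ι l) := by
    have e := OpensGlueDatum.t_ι (deformationGlueDatum halg R U b hb ψ 𝔫 h𝔫 hψ hcoc) j l
    change transitionMap halg R U ψ j l ≫ (deformationGlueDatum halg R U b hb ψ 𝔫 h𝔫 hψ hcoc).glueData.ι l = (chartOverlap R U j l).ι ≫ (deformationGlueDatum halg R U b hb ψ 𝔫 h𝔫 hψ hcoc).glueData.ι j at e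
    rw [← ha, Category.assoc, ← e, ← Category.assoc, ← hb', Category.assoc]
  -- reading of a restricted section = `appTop` of the test morphism applied to the chart reading
  have read : ∀ {C' : Scheme.{u}} (g : C' ⟶ (deformationGlueDatum halg R U b hb ψ 𝔫 h𝔫 hψ hcoc).glueData.glued) [IsOpenImmersion g] (q : (O : Scheme.{u}) ⟶ C')
      (hq : O.ι ≫ (deformationGlueDatum halg R U b hb ψ 𝔫 h𝔫 hψ hcoc).glueData.ι j = q ≫ g) (V : (deformationGlueDatum halg R U b hb ψ 𝔫 h𝔫 hψ hcoc).glueData.glued.Opens) (hg : ⊤ ≤ g ⁻¹ᵁ V)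
      (hle : ((deformationGlueDatum halg R U b hb ψ 𝔫 h𝔫 hψ hcoc).glueData.ι j).opensRange ⊓ ((deformationGlueDatum halg R U b hb ψ 𝔫 h𝔫 hψ hcoc).glueData.ι l).opensRange ⊓ ((deformationGlueDatum halg R U b hb ψ 𝔫 h𝔫 hψ hcoc).glueData.ι m).opensRange ≤ V)
      (x : Γ((deformationGlueDatum halg R U b hb ψ 𝔫 h𝔫 hψ hcoc).glueData.glued, V)),
      (O.ι ≫ (deformationGlueDatum halg R U b hb ψ 𝔫 h𝔫 hψ hcoc).glueData.ι j).appLE _ ⊤ hF ((deformationGlueDatum halg R U b hb ψ 𝔫 h𝔫 hψ hcoc).glueData.glued.presheaf.map (homOfLE hle).op x) =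
        q.appTop (g.appLE V ⊤ hg x) := by
    intro C' g _ q hq V hg hle x
    rw [← CommRingCat.comp_apply, Scheme.Hom.map_appLE, appLE_eq_of_eq hq, ← CommRingCat.comp_apply,
      Scheme.Hom.appTop, Scheme.Hom.app_eq_appLE, Scheme.Hom.appLE_comp_appLE]
    rfl
  have r₁ := read _ a hFa _ (top_le_preimage_opensRange_inf halg R U b hb ψ 𝔫 h𝔫 hψ hcoc j l) inf_le_left (s j l)
  have r₂ := read _ b' hFb _ (top_le_preimage_opensRange_inf halg R U b hb ψ 𝔫 h𝔫 hψ hcoc l m)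
    (le_inf (inf_le_left.trans inf_le_right) inf_le_right) (s l m)
  have r₃ := read _ c hFc _ (top_le_preimage_opensRange_inf halg R U b hb ψ 𝔫 h𝔫 hψ hcoc j m)
    (le_inf (inf_le_left.trans inf_le_left) inf_le_right) (s j m)
  rw [hs j l] at r₁
  rw [hs l m] at r₂
  rw [hs j m] at r₃
  -- §F read the cocycle of the sections in chart `j`, then use injectivity of `Λ_O` (principal open!)
  have hread := congrArg ((O.ι ≫ (deformationGlueDatum halg R U b hb ψ 𝔫 h𝔫 hψ hcoc).glueData.ι j).appLE _ ⊤ hF) (hmul j l m)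
  rw [map_mul, r₁, r₂, r₃] at hread
  change (a.appTop.hom.comp (overlapRingHom halg R U j l)) (G j l) *
      (b'.appTop.hom.comp (overlapRingHom halg R U l m)) (G l m) =
    (c.appTop.hom.comp (overlapRingHom halg R U j m)) (G j m) at hread
  rw [ejl, elm, ejm] at hread
  change ΛO (Φjl (G j l)) * ΛO (ρjl.symm (Φlm (G l m))) = ΛO (Φjm (G j m)) at hread
  rw [← map_mul] at hread
  -- `O = chartProj⁻¹ (U j ∩ U l ∩ U m)` is the open over the PRINCIPAL open `D(b_{jl} b_{jm})`
  have hV3 : (U j).1 ⊓ (U l).1 ⊓ (U m).1 = X.left.basicOpen (b j l * b j m) := by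
    rw [Scheme.basicOpen_mul, ← hb j l, ← hb j m, ← inf_inf_distrib_left, inf_assoc]
  have hOV : O = chartProj R U j ⁻¹ᵁ ((U j).1 ⊓ (U l).1 ⊓ (U m).1) := by
    rw [hOdef, chartOverlap_eq, chartOverlap_eq, ← Scheme.Hom.preimage_inf, ← inf_inf_distrib_left, ← inf_assoc]
  exact ((chartRingHom_bijective halg (U j).2 (chartProj R U j) rfl (b j l * b j m) hV3 hOV hΛO hΛO').1 hread).symm


include hb h𝔫 hψ in
/-- **Units read units**: if the overlap section `g_{jl}` of `G j l` is a unit, so is `G j l` (the chart ring map over the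
principal open `U j ∩ U l = D(b_{jl})` is bijective). [cite: Hartshorne1977, II Ex. 5.18 (b)] -/
theorem isUnit_of_isUnit_overlapSection {j l : ι}
    (s : Γ((deformationGlueDatum halg R U b hb ψ 𝔫 h𝔫 hψ hcoc).glueData.glued,
      ((deformationGlueDatum halg R U b hb ψ 𝔫 h𝔫 hψ hcoc).glueData.ι j).opensRange ⊓
        ((deformationGlueDatum halg R U b hb ψ 𝔫 h𝔫 hψ hcoc).glueData.ι l).opensRange))
    (hs : ((chartOverlap R U j l).ι ≫ (deformationGlueDatum halg R U b hb ψ 𝔫 h𝔫 hψ hcoc).glueData.ι j).appLE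
        (((deformationGlueDatum halg R U b hb ψ 𝔫 h𝔫 hψ hcoc).glueData.ι j).opensRange ⊓
          ((deformationGlueDatum halg R U b hb ψ 𝔫 h𝔫 hψ hcoc).glueData.ι l).opensRange) ⊤
        (top_le_preimage_opensRange_inf halg R U b hb ψ 𝔫 h𝔫 hψ hcoc j l) s =
      overlapRingHom halg R U j l (G j l))
    (hsu : IsUnit s) : IsUnit (G j l) := by
  have hbij := chartRingHom_bijective halg (U j).2 (chartProj R U j) rfl (b j l) (hb j l) (chartOverlap_eq R U j l)
    (overlapRingHom_tmul_one halg R U j l) (overlapRingHom_one_tmul halg R U j l)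
  have h : IsUnit (RingEquiv.ofBijective (overlapRingHom halg R U j l) hbij (G j l)) := by
    change IsUnit (overlapRingHom halg R U j l (G j l))
    rw [← hs]
    exact hsu.map _
  exact (isUnit_map_iff _ _).mp h

include hb h𝔫 hψ in
/-- **FRAMES ON THE CHART IMAGES ↦ AN EXACT TWISTED UNIT COCYCLE** (the converse of
`…GlueLineBundle.exists_rankOne_frames_of_twistedCocycle`).  Let `M` be an `𝒪_{X'}`-module on the glued deformation
`X' = Glue_R(ψ)` with rank-one frames `f_j : 𝒪 ≅ M|_{ι j (C j)}` on the chart images.  Then there are UNITS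
`G j l ∈ R ⊗_k Γ(U j ∩ U l)` and sections `g_{jl} ∈ Γ(X', ι j (C j) ∩ ι l (C l))` such that: `g_{jl}` has chart-`j` reading
`Λ_{jl} (G j l)` (the overlap-section characterisation of `…GlueLineBundleCocycle`), the `G j l` satisfy the EXACT TWISTED cocycle
identity `Φjm (G j m) = Φjl (G j l) · τjl (Φlm (G l m))` for all characterised `Φ`, `τjl` (the input shape of
`Deformation/PairLiftTwistedCocycleObstruction` and of `…GlueLineBundleCocycle.overlapSection_mul`), and the transition functions of the
frames are the `g_{jl}`: `T(f_j, f_l) = (g_{jl}|_V)` over every `V ⊆ ι j (C j) ∩ ι l (C l)` (the `L'`-slot of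
`…GlueLineBundleBaseChange.nonempty_pullback_iso_of_overlapSections`).  (Hartshorne II Ex. 5.18 (b): a locally free sheaf
trivialised on a cover IS its transition data; read in the charts of the glued deformation through the bijective chart ring
maps.) [cite: Hartshorne1977, II Ex. 5.18 (b)] [cite: Hartshorne2010, Thm. 6.4 (a) (proof, pp. 50–51)] [cite: StacksProject, Tag 01JA] -/
theorem exists_twistedCocycle_of_frames
    (M : (deformationGlueDatum halg R U b hb ψ 𝔫 h𝔫 hψ hcoc).glueData.glued.Modules)
    (fM : ∀ j, SheafOfModules.free (PUnit : Type u) ≅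
      M.over ((deformationGlueDatum halg R U b hb ψ 𝔫 h𝔫 hψ hcoc).glueData.ι j).opensRange) :
    ∃ (G : (j l : ι) → R ⊗[k] Γ(X.left, (U j).1 ⊓ (U l).1))
      (s : (j l : ι) →
        Γ((deformationGlueDatum halg R U b hb ψ 𝔫 h𝔫 hψ hcoc).glueData.glued,
          ((deformationGlueDatum halg R U b hb ψ 𝔫 h𝔫 hψ hcoc).glueData.ι j).opensRange ⊓
            ((deformationGlueDatum halg R U b hb ψ 𝔫 h𝔫 hψ hcoc).glueData.ι l).opensRange)),
      (∀ j l, IsUnit (G j l)) ∧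
      (∀ j l, ((chartOverlap R U j l).ι ≫ (deformationGlueDatum halg R U b hb ψ 𝔫 h𝔫 hψ hcoc).glueData.ι j).appLE
          (((deformationGlueDatum halg R U b hb ψ 𝔫 h𝔫 hψ hcoc).glueData.ι j).opensRange ⊓
            ((deformationGlueDatum halg R U b hb ψ 𝔫 h𝔫 hψ hcoc).glueData.ι l).opensRange) ⊤
          (top_le_preimage_opensRange_inf halg R U b hb ψ 𝔫 h𝔫 hψ hcoc j l) (s j l) =
        overlapRingHom halg R U j l (G j l)) ∧
      (∀ (j l m : ι)
        (Φjl : R ⊗[k] Γ(X.left, (U j).1 ⊓ (U l).1) →ₐ[R] R ⊗[k] Γ(X.left, (U j).1 ⊓ (U l).1 ⊓ (U m).1))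
        (_ : ∀ a s, Φjl (a ⊗ₜ s) = a ⊗ₜ X.left.presheaf.map (homOfLE inf_le_left).op s)
        (Φlm : R ⊗[k] Γ(X.left, (U l).1 ⊓ (U m).1) →ₐ[R] R ⊗[k] Γ(X.left, (U j).1 ⊓ (U l).1 ⊓ (U m).1))
        (_ : ∀ a s, Φlm (a ⊗ₜ s) = a ⊗ₜ X.left.presheaf.map
          (homOfLE (le_inf (inf_le_left.trans inf_le_right) inf_le_right)).op s)
        (Φjm : R ⊗[k] Γ(X.left, (U j).1 ⊓ (U m).1) →ₐ[R] R ⊗[k] Γ(X.left, (U j).1 ⊓ (U l).1 ⊓ (U m).1))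
        (_ : ∀ a s, Φjm (a ⊗ₜ s) = a ⊗ₜ X.left.presheaf.map
          (homOfLE (le_inf (inf_le_left.trans inf_le_left) inf_le_right)).op s)
        (τjl : R ⊗[k] Γ(X.left, (U j).1 ⊓ (U l).1 ⊓ (U m).1) ≃ₐ[R] R ⊗[k] Γ(X.left, (U j).1 ⊓ (U l).1 ⊓ (U m).1)),
        (∀ x, τjl (Φjl (ψ j l x)) = Φjl x) → Φjm (G j m) = Φjl (G j l) * τjl (Φlm (G l m))) ∧
      ∀ (j l : ι) (V : (deformationGlueDatum halg R U b hb ψ 𝔫 h𝔫 hψ hcoc).glueData.glued.Opens)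
        (hj : V ≤ ((deformationGlueDatum halg R U b hb ψ 𝔫 h𝔫 hψ hcoc).glueData.ι j).opensRange)
        (hl : V ≤ ((deformationGlueDatum halg R U b hb ψ 𝔫 h𝔫 hψ hcoc).glueData.ι l).opensRange),
        transition (fM j) (fM l) (homOfLE hj) (homOfLE hl) =
          Matrix.of fun _ _ => secRes (deformationGlueDatum halg R U b hb ψ 𝔫 h𝔫 hψ hcoc).glueData.glued
            (le_inf hj hl) (s j l) := by
  obtain ⟨s, hsdef⟩ : ∃ s : (j l : ι) →
      Γ((deformationGlueDatum halg R U b hb ψ 𝔫 h𝔫 hψ hcoc).glueData.glued,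
        ((deformationGlueDatum halg R U b hb ψ 𝔫 h𝔫 hψ hcoc).glueData.ι j).opensRange ⊓
          ((deformationGlueDatum halg R U b hb ψ 𝔫 h𝔫 hψ hcoc).glueData.ι l).opensRange),
      ∀ j l, s j l = transition (fM j) (fM l) (homOfLE inf_le_left) (homOfLE inf_le_right) PUnit.unit PUnit.unit :=
    ⟨fun j l => transition (fM j) (fM l) (homOfLE inf_le_left) (homOfLE inf_le_right) PUnit.unit PUnit.unit, fun _ _ => rfl⟩
  have hsT : ∀ (j l : ι) (V : (deformationGlueDatum halg R U b hb ψ 𝔫 h𝔫 hψ hcoc).glueData.glued.Opens)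
      (hj : V ≤ ((deformationGlueDatum halg R U b hb ψ 𝔫 h𝔫 hψ hcoc).glueData.ι j).opensRange)
      (hl : V ≤ ((deformationGlueDatum halg R U b hb ψ 𝔫 h𝔫 hψ hcoc).glueData.ι l).opensRange),
      transition (fM j) (fM l) (homOfLE hj) (homOfLE hl) =
        Matrix.of fun _ _ => secRes (deformationGlueDatum halg R U b hb ψ 𝔫 h𝔫 hψ hcoc).glueData.glued
          (le_inf hj hl) (s j l) := by
    intro j l V hj hl
    have e := transition_map (fM j) (fM l) (homOfLE inf_le_left) (homOfLE inf_le_right) (homOfLE (le_inf hj hl))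
    rw [Subsingleton.elim (homOfLE (le_inf hj hl) ≫ homOfLE inf_le_left) (homOfLE hj),
      Subsingleton.elim (homOfLE (le_inf hj hl) ≫ homOfLE inf_le_right) (homOfLE hl)] at e
    rw [← e]
    ext ⟨⟩ ⟨⟩
    rw [Matrix.map_apply, Matrix.of_apply, hsdef]
  have hmul : ∀ j l m : ι,
      secRes (deformationGlueDatum halg R U b hb ψ 𝔫 h𝔫 hψ hcoc).glueData.glued
        (inf_le_left : ((deformationGlueDatum halg R U b hb ψ 𝔫 h𝔫 hψ hcoc).glueData.ι j).opensRange ⊓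
            ((deformationGlueDatum halg R U b hb ψ 𝔫 h𝔫 hψ hcoc).glueData.ι l).opensRange ⊓
            ((deformationGlueDatum halg R U b hb ψ 𝔫 h𝔫 hψ hcoc).glueData.ι m).opensRange ≤ _) (s j l) *
      secRes (deformationGlueDatum halg R U b hb ψ 𝔫 h𝔫 hψ hcoc).glueData.glued
        (le_inf (inf_le_left.trans inf_le_right) inf_le_right :
          ((deformationGlueDatum halg R U b hb ψ 𝔫 h𝔫 hψ hcoc).glueData.ι j).opensRange ⊓
            ((deformationGlueDatum halg R U b hb ψ 𝔫 h𝔫 hψ hcoc).glueData.ι l).opensRange ⊓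
            ((deformationGlueDatum halg R U b hb ψ 𝔫 h𝔫 hψ hcoc).glueData.ι m).opensRange ≤
          ((deformationGlueDatum halg R U b hb ψ 𝔫 h𝔫 hψ hcoc).glueData.ι l).opensRange ⊓
            ((deformationGlueDatum halg R U b hb ψ 𝔫 h𝔫 hψ hcoc).glueData.ι m).opensRange) (s l m) =
      secRes (deformationGlueDatum halg R U b hb ψ 𝔫 h𝔫 hψ hcoc).glueData.glued
        (le_inf (inf_le_left.trans inf_le_left) inf_le_right :
          ((deformationGlueDatum halg R U b hb ψ 𝔫 h𝔫 hψ hcoc).glueData.ι j).opensRange ⊓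
            ((deformationGlueDatum halg R U b hb ψ 𝔫 h𝔫 hψ hcoc).glueData.ι l).opensRange ⊓
            ((deformationGlueDatum halg R U b hb ψ 𝔫 h𝔫 hψ hcoc).glueData.ι m).opensRange ≤
          ((deformationGlueDatum halg R U b hb ψ 𝔫 h𝔫 hψ hcoc).glueData.ι j).opensRange ⊓
            ((deformationGlueDatum halg R U b hb ψ 𝔫 h𝔫 hψ hcoc).glueData.ι m).opensRange) (s j m) := by
    intro j l m
    have e := transition_mul (fM j) (fM l) (fM m)
      (homOfLE (inf_le_left.trans inf_le_left :
        ((deformationGlueDatum halg R U b hb ψ 𝔫 h𝔫 hψ hcoc).glueData.ι j).opensRange ⊓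
          ((deformationGlueDatum halg R U b hb ψ 𝔫 h𝔫 hψ hcoc).glueData.ι l).opensRange ⊓
          ((deformationGlueDatum halg R U b hb ψ 𝔫 h𝔫 hψ hcoc).glueData.ι m).opensRange ≤ _))
      (homOfLE (inf_le_left.trans inf_le_right)) (homOfLE inf_le_right)
    rw [hsT, hsT, hsT] at e
    have e' := congrFun (congrFun e PUnit.unit) PUnit.unit
    simp only [Matrix.mul_apply, Matrix.of_apply, Finset.univ_unique, Finset.sum_singleton] at e'
    exact e'
  have hsu : ∀ j l, IsUnit (s j l) := fun j l => by
    have e := transition_mul_symm (fM j) (fM l)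
      (homOfLE (inf_le_left : ((deformationGlueDatum halg R U b hb ψ 𝔫 h𝔫 hψ hcoc).glueData.ι j).opensRange ⊓
        ((deformationGlueDatum halg R U b hb ψ 𝔫 h𝔫 hψ hcoc).glueData.ι l).opensRange ≤ _)) (homOfLE inf_le_right)
    have e' := congrFun (congrFun e PUnit.unit) PUnit.unit
    simp only [Matrix.mul_apply, Finset.univ_unique, Finset.sum_singleton, Matrix.one_apply_eq] at e'
    rw [← hsdef] at e'
    exact IsUnit.of_mul_eq_one _ e'
  have hex : ∀ j l, ∃ g : R ⊗[k] Γ(X.left, (U j).1 ⊓ (U l).1), overlapRingHom halg R U j l g =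
      ((chartOverlap R U j l).ι ≫ (deformationGlueDatum halg R U b hb ψ 𝔫 h𝔫 hψ hcoc).glueData.ι j).appLE
        (((deformationGlueDatum halg R U b hb ψ 𝔫 h𝔫 hψ hcoc).glueData.ι j).opensRange ⊓
          ((deformationGlueDatum halg R U b hb ψ 𝔫 h𝔫 hψ hcoc).glueData.ι l).opensRange) ⊤
        (top_le_preimage_opensRange_inf halg R U b hb ψ 𝔫 h𝔫 hψ hcoc j l) (s j l) := fun j l =>
    (chartRingHom_bijective halg (U j).2 (chartProj R U j) rfl (b j l) (hb j l) (chartOverlap_eq R U j l)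
      (overlapRingHom_tmul_one halg R U j l) (overlapRingHom_one_tmul halg R U j l)).2 _
  choose G hG using hex
  refine ⟨G, s, fun j l => ?_, fun j l => (hG j l).symm, ?_, hsT⟩
  · exact isUnit_of_isUnit_overlapSection halg R U b hb ψ 𝔫 h𝔫 hψ hcoc G (s j l) (hG j l).symm (hsu j l)
  · exact twistedCocycle_of_overlapSection_mul halg R U b hb ψ 𝔫 h𝔫 hψ hcoc G s (fun j l => (hG j l).symm) hmul

end J2

end Literature.AlgebraicGeometry.Deformation

end
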